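import Literature.Computability.AlgebraicComplexity.PerDetMultiplicityObstruction
import Literature.Computability.AlgebraicComplexity.PerDetHwvCertificateDetDeficit
import HarnessLib

/-!
# `MultObstructionPer3Det4` — the rung-V3 target «a multiplicity obstruction for (per₃, det₄)» as one Prop

Cell `pub-gct-max` (track T, seat lit-2), HOME `run/shared/lean/pub/pub-gct-max/`; ladder row V3 of
`run/shared/lean/pub/ladder-directors/LADDER-Valiant.md` («GCT MULTIPLICITY OBSTRUCTION, FIRST
FEASIBILITY: a partition λ ⊢ 4d with mult_λ ℂ[GL₁₆·t·per₃‾]_d > mult_λ ℂ[Ω₄]_d, Ω₄ = GL₁₆·det₄‾ —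
witnessing the KNOWN separation dc̄(per₃) ≥ 5 by an obstruction … to type `MultObstructionPer3Det4`
under Summits/PneNP/GCT»); HUMAN RULING D-0041 (the cell's PLAN OF RECORD: «(per₃, det₄) first true
multiplicity obstruction at syzygy-predicted types d = 9–12 … DATA → KERNEL OBSTRUCTION → INFINITE
FAMILY»). HONEST FRAMING: this file DEFINES the target statement and proves only how the tree's
certificate coordinates and consequences attach to it; it asserts nothing — TYPING A STATEMENT IS
NOT EVIDENCE FOR IT. Whether a multiplicity obstruction exists for any pair `(per_m, det_n)` with
`m ≥ 3` is OPEN (Bläser–Ikenmeyer 2025 §12.4; Bürgisser 2024 §7.4 «any result on the principal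
feasibility … would be highly welcome»); `(3,4)` is a KNOWN separation (`x₀₀·per₃ ∉ Ω₄`, i.e.
`dc̄(per₃) ≥ 5`: Landsberg–Manivel–Ressayre 2013, `dc̄(per_m) ≥ m²/2`, Landsberg 2017 Thm 6.5.2.3), so
the Prop, if ever proved, VALIDATES THE METHOD of multiplicity obstructions — the door that
Bürgisser–Ikenmeyer–Panova leave open after ruling out OCCURRENCE obstructions for `n ≥ m²⁵`
(JAMS 2019 Thm 1.4; at `(3,4)` itself neither kind of obstruction is decided in print) — and gives
no new lower bound; nothing here is a claim on VP ≠ VNP or P ≠ NP. A hypothesis-shape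
`def … : Prop` on the Summits side (like `MultObstructionsBeyondPoly` of `SufficesForValiant.lean`),
not a Literature fact and not an `@[conjecture]` node of a route.

* `MultObstructionPer3Det4 : Prop` — some highest weight `χ` of `GL₁₆` (lexicographic Borel on
  `MatIdx 4`) has `mult_χ ℂ[Δ(det₄)] < mult_χ ℂ[Δ(x₀₀·per₃)]`: the tree predicate
  `PerDetMultiplicityObstruction (k := ℂ) 3 4 χ` (`PerDetMultiplicityObstruction.lean`; letters
  `(n, m) = (3, 4)` = (permanent, determinant); fresh-variable padding `paddedPerFormLex ℂ 3 4`).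
* `multObstructionPer3Det4_iff` — unfolding to the strict inequality of orbit-closure
  multiplicities at some weight.
* `multObstructionPer3Det4_of_at` — certificate coordinates feed it: any
  `PerDetMultiplicityObstructionAt (k := ℂ) 3 4 d λ` (`λ ⊢ 4d`, `ℓ(λ) ≤ 16`; the shape a per-side
  rank certificate plus a det-side bound produces) gives `MultObstructionPer3Det4`.
* `not_hasBorderDetRepr_of_multObstructionPer3Det4` — the Prop implies `¬ HasBorderDetRepr ℂ 3 4`
  (`x₀₀·per₃ ∉ Δ(det₄)`, the multiplicity-obstruction principle as proved in the tree,
  `not_hasBorderDetRepr_of_perDetMultiplicityObstruction`) — a KNOWN fact, which is the point: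
  the rung asks for the first obstruction-theoretic PROOF of a known separation.
* `multObstructionPer3Det4_of_at_eq`, `multObstructionPer3Det4_of_cert` (appended,
  lit-2 gen 29) — THE TYPED CHAIN AS ONE ARROW: a per-side rank certificate `c : TableauEval.Cert`
  with `c.n = 3`, `c.m = 4`, `c.verify = true`, `c.canonical = true` (both decidable, `decide +kernel`
  on a data file) together with the det₄-side strict deficit HYPOTHESIS
  `hdet : mult_{λ*} ℂ[Δ(det₄)] < c.r` proves `MultObstructionPer3Det4` — by the Literature glue
  `TableauEval.Cert.perDetMultiplicityObstructionAt_of_det_lt` (`PerDetHwvCertificateDetDeficit.lean`)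
  and `multObstructionPer3Det4_of_at`. THE DET-SIDE INEQUALITY IS A HYPOTHESIS: no certificate and
  no obstruction is asserted here; what an unconditional instance still needs is exactly one
  det₄-side strict deficit at some type `λ`.

## References

* M. Bläser, C. Ikenmeyer, *Introduction to geometric complexity theory*, Theory of Computing
  Graduate Surveys (2025), §12.4. [BlaeserIkenmeyer2025]
* P. Bürgisser, C. Ikenmeyer, G. Panova, *No occurrence obstructions in geometric complexity
  theory*, J. AMS 32 (2019), §1.1, §1.4. [BurgisserIkenmeyerPanovaJAMS2019]
* P. Bürgisser, J. M. Landsberg, L. Manivel, J. Weyman, SIAM J. Comput. 40 (2011), §1, Prop. 5.2.1.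
  [BLMW2011]
-/

noncomputable section

namespace Summit.PneNP.GCT

open Literature.Computability.AlgebraicComplexity Literature.NumberTheory.DiophantineGeometry

/-- **Rung V3 target — a multiplicity obstruction for `(per₃, det₄)`**: some highest weight `χ` of
`GL₁₆` with `mult_χ ℂ[Δ(det₄)] < mult_χ ℂ[Δ(x₀₀·per₃)]` (tree predicate
`PerDetMultiplicityObstruction (k := ℂ) 3 4 χ`, which carries `3 ≤ 4`). OPEN; asserted nowhere in
the tree; typing it is not evidence for it. `(3,4)` is a KNOWN separation (`dc̄(per₃) ≥ 5`,
LMR 2013), so a proof would validate the multiplicity-obstruction METHOD (BIP 2019 rule out only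
OCCURRENCE obstructions, and only for `n ≥ m²⁵`), not give a new bound; nothing on VP vs VNP or
P vs NP. Bürgisser–Ikenmeyer–Panova 2019 §1.4 («comparing multiplicities … a more refined
approach»); Bläser–Ikenmeyer 2025 §12.4. [cite: BlaeserIkenmeyer2025, §12.4] -/
def MultObstructionPer3Det4 : Prop :=
  ∃ χ : Weight (MatIdx 4), PerDetMultiplicityObstruction (k := ℂ) 3 4 χ

/-- Unfolding: `MultObstructionPer3Det4` is the existence of a weight at which the det₄ orbit-closure
multiplicity is strictly below the padded-per₃ one. [folklore] -/
theorem multObstructionPer3Det4_iff :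
    MultObstructionPer3Det4 ↔ ∃ χ : Weight (MatIdx 4),
      orbitMultiplicity ℂ (detFormLex ℂ 4) 4 χ < orbitMultiplicity ℂ (paddedPerFormLex ℂ 3 4) 4 χ := by
  refine ⟨fun ⟨χ, h⟩ => ⟨χ, (perDetMultiplicityObstruction_iff.mp h).2⟩, fun ⟨χ, h⟩ => ⟨χ, ?_⟩⟩
  exact perDetMultiplicityObstruction_iff.mpr ⟨by norm_num, h⟩

/-- **Certificate coordinates feed the target**: an obstruction at `(n, m, d, λ) = (3, 4, d, λ)`
(`λ ⊢ 4d`, `ℓ(λ) ≤ 16` — the shape `TableauEval.Cert`-based theorems conclude) proves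
`MultObstructionPer3Det4`. [folklore] -/
theorem multObstructionPer3Det4_of_at {d : ℕ} {lam : Nat.Partition (4 * d)}
    (h : PerDetMultiplicityObstructionAt (k := ℂ) 3 4 d lam) : MultObstructionPer3Det4 :=
  ⟨_, h.perDetMultiplicityObstruction⟩

/-- **The target implies the (known) separation** `x₀₀·per₃ ∉ Δ(det₄)`, i.e. `¬ HasBorderDetRepr ℂ 3 4`
— the multiplicity-obstruction principle as PROVED in the tree
(`not_hasBorderDetRepr_of_perDetMultiplicityObstruction`; Mulmuley–Sohoni, BLMW 2011 §1,
BIP 2019 §1.1). [cite: BurgisserIkenmeyerPanovaJAMS2019, §1.1] -/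
theorem not_hasBorderDetRepr_of_multObstructionPer3Det4 (h : MultObstructionPer3Det4) :
    ¬ HasBorderDetRepr ℂ 3 4 := by
  obtain ⟨χ, hχ⟩ := h
  exact not_hasBorderDetRepr_of_perDetMultiplicityObstruction hχ

/-- `multObstructionPer3Det4_of_at` with the sizes as propositional equalities (`n = 3`, `m = 4`),
the form in which a certificate record `c : TableauEval.Cert` carries them. [folklore] -/
theorem multObstructionPer3Det4_of_at_eq {n m d : ℕ} [NeZero m] {lam : Nat.Partition (m * d)}
    (hn : n = 3) (hm : m = 4) (h : PerDetMultiplicityObstructionAt (k := ℂ) n m d lam) :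
    MultObstructionPer3Det4 := by
  subst hn hm
  exact multObstructionPer3Det4_of_at h

/-- **The typed chain as one arrow** (cell `pub-gct-max`, D-0041 phase (b), conditional form): a
per-side rank certificate `c` for `(per₃, det₄)` — `c.n = 3`, `c.m = 4`, `c.verify = true`,
`c.canonical = true` — together with the det₄-side strict deficit HYPOTHESIS
`hdet : mult_{λ*} ℂ[Δ(det₄)] < c.r` proves the rung-V3 target `MultObstructionPer3Det4`; composition of
the Literature glue `TableauEval.Cert.perDetMultiplicityObstructionAt_of_det_lt` (verified certificate ⇒
`c.r ≤ mult_{λ*} ℂ[Δ(x₀₀·per₃)]`, hence with `hdet` an obstruction at `(3, 4, c.d, λ)`) with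
`multObstructionPer3Det4_of_at_eq`. THE DET-SIDE INEQUALITY IS A HYPOTHESIS; THIS THEOREM CERTIFIES NO
OBSTRUCTION BY ITSELF. [folklore] -/
theorem multObstructionPer3Det4_of_cert (c : TableauEval.Cert) [NeZero c.m]
    (hn : c.n = 3) (hm : c.m = 4) (h : c.verify = true) (hcan : c.canonical = true)
    (hdet : orbitMultiplicity ℂ (detFormLex ℂ c.m) c.m
      (c.weight (c.lam_pos_of_verify h) (c.lam_sum_of_verify h)) < c.r) :
    MultObstructionPer3Det4 :=
  multObstructionPer3Det4_of_at_eq hn hm (c.perDetMultiplicityObstructionAt_of_det_lt h hcan hdet)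

end Summit.PneNP.GCT
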